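import Mathlib.Computability.Halting
import Literature.Computability.Complexity.Classes
import Literature.Computability.Complexity.Nondeterministic
import Literature.Computability.Complexity.Oracle
import Literature.Computability.Complexity.PolyHierarchy
import Literature.Computability.Complexity.Algebrization
import Literature.Computability.Complexity.CircuitClasses
import HarnessLib

-- provenance: harness21/H21/H21/Statements/PNP/StructuralPH.lean @ 42c9a31 (interim HEAD d8f2665); M5 mechanical rewrite
/-!
# P vs NP: structural theorems — Ladner, relativization, algebrization, PH collapses

Family `PNP` (trunk T-CPLX-CORE), statement file `H21/Statements/PNP/StructuralPH.lean`.
Target statements (all known theorems in print, proofs `sorry`):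

* **pnp.S12** `ladner`: if `P ≠ NP` then `NP \ P` contains a language that is not `NP`-complete
  under polynomial-time Turing (Cook) reductions [Ladner 1975, Thm. 1].
* **pnp.S17** `baker_gill_solovay_eq`, `baker_gill_solovay_ne`: there are recursive oracles
  `A`, `B` with `P^A = NP^A` and `P^B ≠ NP^B` [Baker–Gill–Solovay 1975, Thms. 1–3].
* **pnp.S19** `aaronson_wigderson_collapse`, `aaronson_wigderson_separation`: there are `A` and
  a low-degree extension `Ã` of `A` with `NP^Ã ⊆ P^A`, and `A, Ã` with `NP^A ⊄ P^Ã`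
  [Aaronson–Wigderson 2009, Thms. 5.1 and 5.3].
* **pnp.S15** `karp_lipton`: `NP ⊆ P/poly → PH = Σ₂ᵖ` [Karp–Lipton 1980, Thm. 6.1].
* **pnp.S16** `kannan`: for every `k` there is `L ∈ Σ₂ᵖ ∩ Π₂ᵖ` without circuits of size
  `O(n^k)` [Kannan 1982, Thm. 2].

## Mathlib and H21 notions used

From Mathlib: `ComputablePred` (`Mathlib/Computability/RE.lean`, re-exported by
`Mathlib.Computability.Halting`) with the instance `Primcodable (List Bool)`; "recursive oracle"
is rendered as `ComputablePred (· ∈ A)`. Mathlib has no complexity classes beyond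
`Turing.TM2ComputableInPolyTime` (grep: no `Ladner`, `KarpLipton`, `PH`, `SIZE`, relativised
class), so all classes come from the H21 prelude: `P`, `NP` (`Classes.lean`,
`Nondeterministic.lean`), `PRel`, `NPRel`, `Oracle.ofLanguage`, `PolyTimeTuringReducible`
(`Oracle.lean`), `SigmaP`, `PiP`, `PH` (`PolyHierarchy.lean`), `ExtensionOracle`,
`ExtensionOracle.IsExtensionOf`, `ExtensionOracle.toOracle` (`Algebrization.lean`), `SIZE`,
`PPoly` (`CircuitClasses.lean`). No new definition is introduced in this file.

## Design notes

* Ladner's theorem is stated for Cook (`≤ᵀₚ`) completeness, which is the strong form proved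
  in [Ladner 1975, Thm. 1] (it implies the Karp form since `≤ₚ ⇒ ≤ᵀₚ`).
* Orientation of pnp.S19 (outline R7, re-checked against the paper). With AW's Def. 1.2, the
  *separation* `NP ⊄ P` would algebrize if `NP^Ã ⊄ P^A` for all `A, Ã`; AW Thm. 5.1 refutes
  this by exhibiting `A, Ã` with `NP^Ã ⊆ P^A` (take `A` PSPACE-complete and `Ã` its multilinear
  extension, also in PSPACE). Dually the *inclusion* `NP ⊆ P` would algebrize if `NP^A ⊆ P^Ã`
  for all `A, Ã`; AW Thm. 5.3 refutes this with `A, Ã` such that `NP^A ⊄ P^Ã`. The inventory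
  text ("`NP^Ã ⊆ P^A`" and "`NP^A ⊄ P^Ã`") therefore has the paper's orientation and is
  followed literally. v0 extension oracles range over prime fields only (outline R7); AW's
  constructions in §5 work verbatim for any fixed collection of finite fields containing the
  prime fields.
* Kannan's "size `O(n^k)`" is rendered arithmetically as `⋃ c, SIZE (fun n => c * n ^ k + c)`
  (outline D2 O-form), avoiding asymptotic side conditions at small `n`.
* `Σ₂ᵖ ∩ Π₂ᵖ` is an intersection of *classes* (`Set (Language Bool)`), so `∩` is correct here
  (outline D7 reserves `⊓/⊔` for languages).

## References

* R. E. Ladner, *On the structure of polynomial time reducibility*, J. ACM 22 (1975), Thm. 1.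
* T. Baker, J. Gill, R. Solovay, *Relativizations of the P =? NP question*, SIAM J. Comput. 4
  (1975), Thms. 1–3.
* S. Aaronson, A. Wigderson, *Algebrization: a new barrier in complexity theory*, ACM TOCT 1
  (2009), Def. 1.2, Thms. 5.1, 5.3.
* R. M. Karp, R. J. Lipton, *Some connections between nonuniform and uniform complexity
  classes*, STOC 1980, Thm. 6.1.
* R. Kannan, *Circuit-size lower bounds and non-reducibility to sparse sets*, Inform. Control
  55 (1982), Thm. 2.
* S. Arora, B. Barak, *Computational Complexity: A Modern Approach*, CUP 2009, Thms. 3.3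
  (Ladner), 3.7 (BGS), 6.19 (Karp–Lipton), 6.20 (Kannan).
-/

namespace Literature.Computability.Complexity

open Nondeterministic Classes _root_.Computability

/-! ### Ladner's theorem -/

/-- **pnp.S12** (Ladner's theorem; Ladner 1975, Thm. 1; Arora–Barak 2009, Thm. 3.3).
If `P ≠ NP` then there is a language `L ∈ NP \ P` that is not `NP`-complete under
polynomial-time Turing reductions: not every `L' ∈ NP` satisfies `L' ≤ᵀₚ L`. [cite: Ladner1975, Thm. 1] -/
def ladner : Prop :=
  ∀ (h : P ≠ NP),
    ∃ L ∈ NP, L ∉ P ∧ ¬ ∀ L' ∈ NP, PolyTimeTuringReducible L' L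

/-! ### Relativization (Baker–Gill–Solovay) -/

/-- **pnp.S17** (Baker–Gill–Solovay 1975, Thm. 1; Arora–Barak 2009, Thm. 3.7, first half).
There is a recursive oracle `A ⊆ {0,1}*` with `P^A = NP^A` (e.g. any PSPACE-complete
language). Recursiveness is Mathlib's `ComputablePred` on `List Bool`. [cite: BakerGillSolovay1975, Thm. 1] -/
def baker_gill_solovay_eq : Prop :=
  ∃ A : Language Bool, ComputablePred (· ∈ A) ∧
      PRel (Oracle.ofLanguage A) = NPRel (Oracle.ofLanguage A)

/-- **pnp.S17** (Baker–Gill–Solovay 1975, Thm. 3; Arora–Barak 2009, Thm. 3.7, second half).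
There is a recursive oracle `B ⊆ {0,1}*` with `P^B ≠ NP^B` (diagonalisation against all
polynomial-time oracle machines using the unary language `{1ⁿ | B ∩ {0,1}ⁿ ≠ ∅}`). [cite: BakerGillSolovay1975, Thm. 3] -/
def baker_gill_solovay_ne : Prop :=
  ∃ B : Language Bool, ComputablePred (· ∈ B) ∧
      PRel (Oracle.ofLanguage B) ≠ NPRel (Oracle.ofLanguage B)

/-! ### Algebrization (Aaronson–Wigderson) -/

/-- **pnp.S19** (Aaronson–Wigderson 2009, Thm. 5.1: the separation `NP ⊄ P` does not
algebrize). There are an oracle language `A` and a low-degree extension `Ã` of `A` (of some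
multidegree bound `d`, over the prime fields) such that `NP^Ã ⊆ P^A`. Orientation as in the
paper (AW take `A` PSPACE-complete and `Ã` its multilinear extension); see the module
docstring. [cite: AaronsonWigderson2009, Thm. 5.1: the separation  NP ⊄ P  does n] -/
def aaronson_wigderson_collapse : Prop :=
  ∃ (A : Language Bool) (Ã : ExtensionOracle) (d : ℕ), Ã.IsExtensionOf A d ∧
      NPRel Ã.toOracle ⊆ PRel (Oracle.ofLanguage A)

/-- **pnp.S19** (Aaronson–Wigderson 2009, Thm. 5.3: the inclusion `NP ⊆ P` does not
algebrize). There are an oracle language `A` and a low-degree extension `Ã` of `A` (of some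
multidegree bound `d`, over the prime fields) such that `NP^A ⊄ P^Ã`. Orientation as in the
paper; see the module docstring. [cite: AaronsonWigderson2009, Thm. 5.3: the inclusion  NP ⊆ P  does no] -/
def aaronson_wigderson_separation : Prop :=
  ∃ (A : Language Bool) (Ã : ExtensionOracle) (d : ℕ), Ã.IsExtensionOf A d ∧
      ¬ NPRel (Oracle.ofLanguage A) ⊆ PRel Ã.toOracle

/-! ### Collapses of the polynomial hierarchy -/

/-- **pnp.S15** (Karp–Lipton theorem; Karp–Lipton 1980, Thm. 6.1; Arora–Barak 2009,
Thm. 6.19). If `NP` has polynomial-size circuits then the polynomial hierarchy collapses to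
its second level: `NP ⊆ P/poly → PH = Σ₂ᵖ`. [cite: KarpLipton1980, Thm. 6.1] -/
def karp_lipton : Prop :=
  ∀ (h : NP ⊆ PPoly),
    PH = SigmaP 2

/-- **pnp.S16** (Kannan's theorem; Kannan 1982, Thm. 2 (Information and Control 55, p. 44:
"For any nonnegative integer k, there is a language L_k in Σ₂ᵖ ∩ Π₂ᵖ such that L_k does not
have O(n^k) size circuits"); Arora–Barak 2009, Exercises 6.5–6.6; Jukna 2012, Thm. 20.13 —
note Arora–Barak Thm. 6.20 is Meyer's theorem, not this one). For
every `k` there is a language in `Σ₂ᵖ ∩ Π₂ᵖ` that has no circuit family of size `O(n^k)`,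
the size bound being rendered arithmetically as `c * n ^ k + c` for some constant `c`. [cite: Kannan1982, Thm. 2] -/
def kannan : Prop :=
  ∀ (k : ℕ),
    ∃ L ∈ SigmaP 2 ∩ PiP 2, L ∉ ⋃ c : ℕ, SIZE (fun n => c * n ^ k + c)

end Literature.Computability.Complexity
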